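import Mathlib.RingTheory.PowerSeries.Substitution
import Mathlib.RingTheory.PowerSeries.Expand
import Mathlib.RingTheory.PowerSeries.Derivative
import Mathlib.RingTheory.PowerSeries.Trunc
import Mathlib.RingTheory.PowerSeries.Order
import Mathlib.RingTheory.PowerSeries.NoZeroDivisors
import Mathlib.Algebra.Polynomial.Taylor
import Mathlib.Algebra.CharP.Frobenius
import Mathlib.Algebra.CharP.Quotient
import Mathlib.RingTheory.Ideal.Quotient.Basic
import Mathlib.NumberTheory.Padics.RingHoms
import Mathlib.RingTheory.WittVector.Identities
import Mathlib.RingTheory.WittVector.Domain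
import Mathlib.FieldTheory.Perfect
import Literature.NumberTheory.EllipticCurves.DivisionPolynomialFormalMulProofs
import Literature.NumberTheory.EllipticCurves.FormalGroupHasseInvariantProofs
import Literature.RingTheory.FormalGroups.FunctionalEquationIntegrality
import Literature.NumberTheory.EllipticCurves.FormalGroupMultiplicationUniversalProofs
import Literature.NumberTheory.EllipticCurves.FormalGroupLogHomProofs
import Literature.RingTheory.FormalGroups.HondaTypeTransport
import Literature.NumberTheory.EllipticCurves.FormalMulTwoSecondCoeffProofs
import Mathlib.RingTheory.WittVector.FrobeniusFractionField
import Mathlib.RingTheory.WittVector.Compare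
import Mathlib.FieldTheory.Finite.Basic
import Literature.NumberTheory.EllipticCurves.FormalLogExpBaseChangeProofs
import Mathlib.FieldTheory.IsAlgClosed.AlgebraicClosure
import Mathlib.NumberTheory.Padics.Hensel
import Literature.NumberTheory.EllipticCurves.FormalGroupDictionaryProofs
import Literature.NumberTheory.EllipticCurves.HasseInvariantTraceProofs
import Literature.NumberTheory.EllipticCurves.Greenberg1999.TwoTorsionMuInvariant
import Summits.BirchSwinnertonDyer.BirchSwinnertonDyer.Theorems.EisensteinDepletionAtTwoStarGO2KEtaTheoremKWittB
import HarnessLib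

/-!
# THEOREM K (the 2-adic Kummer class law for `z²(x(z) − x₀)`), kernel formalisation — KEtaTheoremKPadic (part 8)
(crux `StarGO2Sigma`, stmt-BirchSwinnertonDyer-27046; line kummer, research stub `stub_discrepancyCover`)

Planner bsd-rank2-p2 GEN 37's Stage F of the monolith `KummerTheoremK_full.lean` (HOME/p2/g37/lean, lean rc 0, 0 sorries;
memo K-UNIV.md §0/§4), packaged to follow the lead's parts KernelA … TheoremKWittB.  This part: the WITT-FREE CONSUMER FORMS —
the Artin–Schreier root `s̄ = Σ_j Λ̄^{2^j}` over any ring of characteristic 2 and its uniqueness (`ArtinSchreier.asRoot`,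
`as_unique`); the descent of `theoremK_explicit'` along `ℤ₂ → 𝕎(𝔽̄₂)`, `𝔽₂ → 𝔽̄₂` (`theoremK_padicInt`); the curve-side
inputs — Hensel's unit root (`exists_unitRoot_of_odd`), `tr(Frob₂) ≡ a₁ (mod 2)` (`intCast_tr_eq_intCast_a₁`, from the tree's
`coeff_one_formalMulFrobPart_eq_intCast_tr` at `p = 2`), the Honda type from good reduction (`hondaType_of_goodReduction`, tree
`norm_coeff_hondaShift_formalLog_le_one'`); the one-stop forms on the kummer v6 binders `HasRationalTwoTorsionX` /
`¬TwoTorsionRamifiedAtTwo` (`exists_padicInt_twoTorsionX`, `theoremK_padicInt_of_rationalTwoTorsion`) and the line form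
with the `z`-side Dwork witnesses supplied (`theoremK_line`).  Nothing here reads `r_an`; `StarGO2Sigma` / E1M / BSD are NOT
proved by this file.
-/

set_option linter.dupNamespace false
set_option linter.unusedSectionVars false
set_option autoImplicit false

noncomputable section


/-! ## THEOREM K over `ℤ₂ / 𝔽₂` — the Witt-free consumer form

The period `c₀` lives in `𝕎(𝔽̄₂)`, not in `ℤ₂`; but it has disappeared from `theoremK_explicit'`,
whose data (`Λ`, `g`, `ω`, `z`, `d_z`, `δ`) all come from `ℤ₂⟦X⟧` in the application.  We descend the
statement along `ℤ₂ → 𝕎(𝔽̄₂)`, `𝔽₂ → 𝔽̄₂`: the Artin–Schreier root `s̄ = Σ_j Λ̄^{2^j}` is constructed over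
any ring of characteristic `2` (`ArtinSchreier.asRoot`) and is unique (`ArtinSchreier.as_unique`). -/

namespace Summit.BirchSwinnertonDyer.BirchSwinnertonDyer.Theorems.DepletionAtTwo.KEta.ArtinSchreier

open PowerSeries Finset

variable {R : Type*} [CommRing R]

/-- `2 = 0` in `R⟦X⟧` when `R` has characteristic `2`. -/
theorem two_eq_zero_powerSeries [CharP R 2] : (2 : R⟦X⟧) = 0 := by
  have h : (C (2 : R) : R⟦X⟧) = 2 := map_ofNat C 2
  rw [← h, CharTwo.two_eq_zero, map_zero]

/-- `(Σ_{j<N} Λ^{2^j})² = Σ_{j<N} Λ^{2^{j+1}}` in characteristic `2`. -/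
theorem sq_sum_range [CharP R 2] (Λ : R⟦X⟧) (N : ℕ) :
    (∑ j ∈ range N, Λ ^ 2 ^ j) ^ 2 = ∑ j ∈ range N, Λ ^ 2 ^ (j + 1) := by
  induction N with
  | zero => simp
  | succ N ih =>
    rw [sum_range_succ, sum_range_succ, add_sq, ih, mul_assoc, two_eq_zero_powerSeries, zero_mul,
      add_zero, ← pow_mul, ← pow_succ]

/-- The partial sums telescope: `S_N − S_N² = Λ − Λ^{2^N}`. -/
theorem partial_sub_sq [CharP R 2] (Λ : R⟦X⟧) (N : ℕ) :
    (∑ j ∈ range N, Λ ^ 2 ^ j) - (∑ j ∈ range N, Λ ^ 2 ^ j) ^ 2 = Λ - Λ ^ 2 ^ N := by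
  rw [sq_sum_range]
  induction N with
  | zero => simp
  | succ N ih =>
    rw [sum_range_succ, sum_range_succ]
    linear_combination ih

/-- If `Λ(0) = 0` then `Λ^m` has no coefficient in degree `n < m`. -/
theorem coeff_pow_eq_zero_of_lt {Λ : R⟦X⟧} (h0 : constantCoeff Λ = 0) {n m : ℕ} (h : n < m) :
    coeff n (Λ ^ m) = 0 := by
  have hX : (X : R⟦X⟧) ^ m ∣ Λ ^ m := pow_dvd_pow_of_dvd (X_dvd_iff.mpr h0) m
  exact (X_pow_dvd_iff.mp hX) n h

/-- The Artin–Schreier root `Σ_{j ≥ 0} Λ^{2^j}`, defined coefficientwise (the sum is `X`-adically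
convergent when `Λ(0) = 0`). -/
def asRoot (Λ : R⟦X⟧) : R⟦X⟧ :=
  PowerSeries.mk fun n => coeff n (∑ j ∈ range (n + 1), Λ ^ 2 ^ j)

/-- The degree-`n` coefficient of the Artin–Schreier root `Σ_j Λ^{2^j}` is that of any partial sum with `N ≥ n+1` terms. -/
theorem coeff_asRoot_eq {Λ : R⟦X⟧} (h0 : constantCoeff Λ = 0) {n N : ℕ} (hN : n + 1 ≤ N) :
    coeff n (asRoot Λ) = coeff n (∑ j ∈ range N, Λ ^ 2 ^ j) := by
  induction N, hN using Nat.le_induction with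
  | base => rw [asRoot, coeff_mk]
  | succ N hN ih =>
    rw [sum_range_succ, map_add, ← ih, coeff_pow_eq_zero_of_lt h0, add_zero]
    calc n < n + 1 := n.lt_succ_self
      _ ≤ N := hN
      _ < 2 ^ N := Nat.lt_two_pow_self

/-- Truncation of the Artin–Schreier root `asRoot Λ` to degree `< N` equals that of the `N`-term partial sum. -/
theorem trunc_asRoot {Λ : R⟦X⟧} (h0 : constantCoeff Λ = 0) (N : ℕ) :
    trunc N (asRoot Λ) = trunc N (∑ j ∈ range N, Λ ^ 2 ^ j) := by
  ext m
  rw [coeff_trunc, coeff_trunc]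
  split_ifs with hm
  · exact coeff_asRoot_eq h0 hm
  · rfl

/-- The Artin–Schreier root `asRoot Λ` has zero constant term (when `Λ(0) = 0`). -/
theorem constantCoeff_asRoot {Λ : R⟦X⟧} (h0 : constantCoeff Λ = 0) : constantCoeff (asRoot Λ) = 0 := by
  rw [← coeff_zero_eq_constantCoeff_apply, asRoot, coeff_mk, sum_range_one, pow_zero, pow_one,
    coeff_zero_eq_constantCoeff_apply, h0]

/-- `s̄ − s̄² = Λ̄` for `s̄ = asRoot Λ̄`. -/
theorem asRoot_spec [CharP R 2] {Λ : R⟦X⟧} (h0 : constantCoeff Λ = 0) :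
    asRoot Λ - asRoot Λ ^ 2 = Λ := by
  ext n
  have hsq : coeff n (asRoot Λ ^ 2) = coeff n ((∑ j ∈ range (n + 1), Λ ^ 2 ^ j) ^ 2) := by
    rw [pow_two, pow_two, coeff_mul_eq_coeff_trunc_mul_trunc _ _ n.lt_succ_self,
      coeff_mul_eq_coeff_trunc_mul_trunc (∑ j ∈ range (n + 1), Λ ^ 2 ^ j) _ n.lt_succ_self,
      trunc_asRoot h0]
  have hn : n < 2 ^ (n + 1) := calc
    n < n + 1 := n.lt_succ_self
    _ < 2 ^ (n + 1) := Nat.lt_two_pow_self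
  rw [map_sub, hsq, coeff_asRoot_eq h0 le_rfl, ← map_sub, partial_sub_sq, map_sub,
    coeff_pow_eq_zero_of_lt h0 hn, sub_zero]

/-- Uniqueness of the Artin–Schreier root with zero constant term (any ring). -/
theorem as_unique {s t Λ : R⟦X⟧} (hs : s - s ^ 2 = Λ) (ht : t - t ^ 2 = Λ)
    (hs0 : constantCoeff s = 0) (ht0 : constantCoeff t = 0) : s = t := by
  have h : (s - t) * (1 - (s + t)) = 0 := by linear_combination hs - ht
  have hu : IsUnit (1 - (s + t)) := by
    rw [PowerSeries.isUnit_iff_constantCoeff, map_sub, map_add, map_one, hs0, ht0, add_zero, sub_zero]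
    exact isUnit_one
  exact sub_eq_zero.mp (hu.mul_left_eq_zero.mp h)

end Summit.BirchSwinnertonDyer.BirchSwinnertonDyer.Theorems.DepletionAtTwo.KEta.ArtinSchreier

namespace Summit.BirchSwinnertonDyer.BirchSwinnertonDyer.Theorems.DepletionAtTwo.KEta.TheoremKPadic

open PowerSeries Literature.RingTheory.FormalGroups Literature.NumberTheory.EllipticCurves WittExistence TheoremKWitt

/-- Ring homomorphisms out of `ℤ₂` into a ring of characteristic `2` coincide (both factor through
`ℤ₂/2 = 𝔽₂`). -/
theorem ringHom_ext_of_charTwo {S : Type*} [CommRing S] [CharP S 2] (f g : ℤ_[2] →+* S) : f = g := by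
  ext x
  have hx := PadicInt.toZMod_spec x
  rw [PadicInt.maximalIdeal_eq_span_p, Ideal.mem_span_singleton'] at hx
  obtain ⟨y, hy⟩ := hx
  have hx' : x = ((PadicInt.toZMod x).cast : ℤ_[2]) + y * ((2 : ℕ) : ℤ_[2]) := by
    rw [hy]; ring
  rw [hx', ZMod.cast_eq_val, map_add, map_add, map_mul, map_mul, map_natCast, map_natCast,
    map_natCast, map_natCast, CharP.cast_eq_zero S 2, mul_zero, mul_zero]

section descent

variable (k : Type*) [Field k] [IsAlgClosed k] [CharP k 2]

/-- Reduction `𝕎(k) → k` after the descent map `ι : ℤ₂ → 𝕎(k)` is `ℤ₂ → 𝔽₂ → k`. -/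
theorem constantCoeff_comp_iota :
    (WittVector.constantCoeff : WittVector 2 k →+* k).comp (iota k) =
      (ZMod.castHom (dvd_refl 2) k).comp (PadicInt.toZMod (p := 2)) :=
  ringHom_ext_of_charTwo _ _

/-- Coefficientwise form of `constantCoeff_comp_iota` on power series over `ℤ₂`. -/
theorem map_iota_map_constantCoeff (u : PowerSeries ℤ_[2]) :
    (u.map (iota k)).map (WittVector.constantCoeff : WittVector 2 k →+* k) =
      (u.map (PadicInt.toZMod (p := 2))).map (ZMod.castHom (dvd_refl 2) k) := by
  rw [Kernel.map_map_apply', Kernel.map_map_apply', constantCoeff_comp_iota]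

/-- The Witt-vector Frobenius fixes the image of `ι : ℤ₂ → 𝕎(k)` (Frobenius of `ℤ₂` is the identity). -/
theorem frobenius_comp_iota :
    (WittVector.frobenius : WittVector 2 k →+* WittVector 2 k).comp (iota k) =
      (iota k).comp (RingHom.id ℤ_[2]) := by
  ext x
  simp [frobenius_iota]

/-- The Frobenius-twisted substitution `φ` commutes with the descent map `ι : ℤ₂ → 𝕎(k)` on power series. -/
theorem map_iota_phi (u : PowerSeries ℤ_[2]) :
    (Kernel.phi (RingHom.id ℤ_[2]) u).map (iota k) =
      Kernel.phi (WittVector.frobenius : WittVector 2 k →+* WittVector 2 k) (u.map (iota k)) := by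
  rw [Kernel.phi_def, Kernel.phi_def, map_expand, Kernel.map_map_apply', Kernel.map_map_apply',
    frobenius_comp_iota]

/-- Base change of a Weierstrass curve `W/ℤ` along `ℤ → ℤ₂ → 𝕎(k)` is its base change along `ℤ → 𝕎(k)`. -/
theorem map_iota_weierstrass (W : WeierstrassCurve ℤ) :
    (W.map (Int.castRingHom ℤ_[2])).map (iota k) = W.map (Int.castRingHom (WittVector 2 k)) := by
  rw [WeierstrassCurve.map_map]
  congr 1
  exact RingHom.ext_int _ _

end descent

/-- **THEOREM K over `ℤ₂/𝔽₂` (Witt-free, instance-free consumer form of the `2`-adic Kummer class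
law).**  `W/ℤ`; `a ∈ ℤ` with the `2`-adic Honda type `hH`; `α ∈ ℤ₂^×` a root of `X² − aX + 2`; an
integral `2`-adic `2`-torsion `x`-coordinate `x₀ ∈ ℤ₂`; `a₁` odd.  Then with
`Λ̄ := λ_α(log_W) mod 2 ∈ 𝔽₂⟦X⟧` there is `s̄ ∈ 𝔽₂⟦X⟧`, `s̄(0) = 0`, `s̄ − s̄² = Λ̄`, such that for every
`z ∈ Xℤ₂⟦X⟧` with `z(X²) = z² + 2d_z` and every `δ` with `(g∘z)(X²) = (g∘z)² + 2δ`,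
`g = X²(x(X) − x₀)`:  `δ mod 2 = (g∘z mod 2)² · ( s̄∘z̄ + (ω̄∘z̄)²·(d_z mod 2) )` in `𝔽₂⟦X⟧`. -/
theorem theoremK_padicInt (W : WeierstrassCurve ℤ) (a : ℤ) {α : ℤ_[2]} (hαn : ‖α‖ = 1)
    (hroot : (α : ℚ_[2]) ^ 2 - a * α + 2 = 0)
    (hH : ∀ n, ‖coeff n (hondaShift 2 (a : ℚ_[2]) (W.map (Int.castRingHom ℚ_[2])).formalLog)‖ ≤ 1)
    {x₀ : ℤ_[2]}
    (hx : 4 * x₀ ^ 3 + (W.map (Int.castRingHom ℤ_[2])).b₂ * x₀ ^ 2 +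
      2 * (W.map (Int.castRingHom ℤ_[2])).b₄ * x₀ + (W.map (Int.castRingHom ℤ_[2])).b₆ = 0)
    (ha1 : Odd W.a₁) :
    ∃ sbar : PowerSeries (ZMod 2), constantCoeff sbar = 0 ∧
      sbar - sbar ^ 2 = (lamInt W a hαn hroot hH).map (PadicInt.toZMod (p := 2)) ∧
      ∀ (z dz δgz : PowerSeries ℤ_[2]), constantCoeff z = 0 →
        Kernel.phi (RingHom.id ℤ_[2]) z = z ^ 2 + 2 * dz →
        Kernel.phi (RingHom.id ℤ_[2])
            (((W.map (Int.castRingHom ℤ_[2])).formalXMulSq - C x₀ * X ^ 2).subst z) =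
          (((W.map (Int.castRingHom ℤ_[2])).formalXMulSq - C x₀ * X ^ 2).subst z) ^ 2 + 2 * δgz →
        δgz.map (PadicInt.toZMod (p := 2)) =
          (PowerSeries.map (PadicInt.toZMod (p := 2))
              (((W.map (Int.castRingHom ℤ_[2])).formalXMulSq - C x₀ * X ^ 2).subst z)) ^ 2 *
            (sbar.subst (z.map (PadicInt.toZMod (p := 2))) +
              ((((W.map (Int.castRingHom ℤ_[2])).formalInvDiff).map (PadicInt.toZMod (p := 2))).subst
                  (z.map (PadicInt.toZMod (p := 2)))) ^ 2 *
                dz.map (PadicInt.toZMod (p := 2))) := by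
  -- the auxiliary algebraically closed field
  let k := AlgebraicClosure (ZMod 2)
  set ρ : ℤ_[2] →+* ZMod 2 := PadicInt.toZMod (p := 2) with hρ
  set θ : ZMod 2 →+* k := ZMod.castHom (dvd_refl 2) k with hθ
  set ι : ℤ_[2] →+* WittVector 2 k := iota k with hι
  set π : WittVector 2 k →+* k := WittVector.constantCoeff with hπ
  have hθi : Function.Injective θ := θ.injective
  set W₂ := W.map (Int.castRingHom ℤ_[2]) with hW₂
  set WO := W.map (Int.castRingHom (WittVector 2 k)) with hWO
  have hWmap : W₂.map ι = WO := map_iota_weierstrass k W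
  set Λ2 := (lamInt W a hαn hroot hH).map ρ with hΛ2
  have hΛ0 : constantCoeff Λ2 = 0 := by
    rw [← coeff_zero_eq_constantCoeff_apply, hΛ2, coeff_map, coeff_zero_eq_constantCoeff_apply,
      constantCoeff_lamInt, map_zero]
  refine ⟨ArtinSchreier.asRoot Λ2, ArtinSchreier.constantCoeff_asRoot hΛ0,
    ArtinSchreier.asRoot_spec hΛ0, ?_⟩
  intro z dz δgz hz0 hzφ hgz
  -- hypotheses over 𝕎(k)
  have hx' : 4 * ι x₀ ^ 3 + WO.b₂ * ι x₀ ^ 2 + 2 * WO.b₄ * ι x₀ + WO.b₆ = 0 := by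
    have h := congrArg ι hx
    rw [← hWmap]
    simp only [map_add, map_mul, map_pow, map_ofNat, map_zero, WeierstrassCurve.map_b₂,
      WeierstrassCurve.map_b₄, WeierstrassCurve.map_b₆] at h ⊢
    exact h
  have ha1' : π WO.a₁ = 1 := by
    obtain ⟨m, hm⟩ := ha1
    have h2k : (2 : k) = 0 := CharTwo.two_eq_zero
    rw [hWO, WeierstrassCurve.map_a₁, eq_intCast, map_intCast, hm, Int.cast_add, Int.cast_mul, Int.cast_ofNat,
      Int.cast_one, h2k, zero_mul, zero_add]
  have hzs : HasSubst z := HasSubst.of_constantCoeff_zero' hz0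
  have hz0' : constantCoeff (z.map ι) = 0 := by
    rw [← coeff_zero_eq_constantCoeff_apply, coeff_map, coeff_zero_eq_constantCoeff_apply, hz0, map_zero]
  have hzφ' : Kernel.phi (WittVector.frobenius : WittVector 2 k →+* WittVector 2 k) (z.map ι) =
      z.map ι ^ 2 + 2 * dz.map ι := by
    rw [← map_iota_phi, hzφ, map_add, map_pow, map_mul, map_ofNat]
  have hg : (W₂.formalXMulSq - C x₀ * X ^ 2).map ι = WO.formalXMulSq - C (ι x₀) * X ^ 2 := by
    rw [map_sub, WeierstrassCurve.map_formalXMulSq, hWmap, map_mul, map_C, map_pow, map_X]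
  have hgsub : PowerSeries.map ι ((W₂.formalXMulSq - C x₀ * X ^ 2).subst z) =
      (WO.formalXMulSq - C (ι x₀) * X ^ 2).subst (z.map ι) := by
    rw [Kernel.map_subst_apply' hzs, hg]
  have hgz' : Kernel.phi (WittVector.frobenius : WittVector 2 k →+* WittVector 2 k)
      ((WO.formalXMulSq - C (ι x₀) * X ^ 2).subst (z.map ι)) =
      (WO.formalXMulSq - C (ι x₀) * X ^ 2).subst (z.map ι) ^ 2 + 2 * δgz.map ι := by
    rw [← hgsub, ← map_iota_phi, hgz, map_add, map_pow, map_mul, map_ofNat]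
  -- THEOREM K over 𝕎(k)
  obtain ⟨sk, hsk0, hskAS, H⟩ := theoremK_explicit' k W a hαn hroot hH hx' ha1'
  have H1 := H (z.map ι) (dz.map ι) (δgz.map ι) hz0' hzφ' hgz'
  -- identify `sk` with the image of the `𝔽₂`-root
  have hΛk : lamBar k W a hαn hroot hH = (Λ2.map θ) := by
    rw [lamBar, hΛ2, Kernel.map_map_apply', ← constantCoeff_comp_iota]
  have hsk : sk = (ArtinSchreier.asRoot Λ2).map θ := by
    refine ArtinSchreier.as_unique hskAS ?_ hsk0 ?_
    · rw [← map_pow, ← map_sub, ArtinSchreier.asRoot_spec hΛ0, hΛk]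
    · rw [← coeff_zero_eq_constantCoeff_apply, coeff_map, coeff_zero_eq_constantCoeff_apply,
        ArtinSchreier.constantCoeff_asRoot hΛ0, map_zero]
  -- rewrite every piece of `H1` as a `θ`-image and conclude by injectivity of `θ_*`
  have hzρ0 : constantCoeff (z.map ρ) = 0 := by
    rw [← coeff_zero_eq_constantCoeff_apply, coeff_map, coeff_zero_eq_constantCoeff_apply, hz0, map_zero]
  have hzρs : HasSubst (z.map ρ) := HasSubst.of_constantCoeff_zero' hzρ0
  have e_z : (z.map ι).map π = (z.map ρ).map θ := map_iota_map_constantCoeff k z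
  have e_d : (dz.map ι).map π = (dz.map ρ).map θ := map_iota_map_constantCoeff k dz
  have e_δ : (δgz.map ι).map π = (δgz.map ρ).map θ := map_iota_map_constantCoeff k δgz
  have e_g : PowerSeries.map π ((WO.formalXMulSq - C (ι x₀) * X ^ 2).subst (z.map ι)) =
      (PowerSeries.map ρ ((W₂.formalXMulSq - C x₀ * X ^ 2).subst z)).map θ := by
    rw [← hgsub, map_iota_map_constantCoeff]
  have e_ω : WO.formalInvDiff.map π = (W₂.formalInvDiff.map ρ).map θ := by
    rw [← hWmap, ← WeierstrassCurve.map_formalInvDiff, map_iota_map_constantCoeff]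
  rw [e_δ, e_g, e_z, e_d, e_ω, hsk] at H1
  apply PowerSeries.map_injective θ hθi
  simp only [map_mul, map_add, map_pow]
  rw [Kernel.map_subst_apply' hzρs θ (ArtinSchreier.asRoot Λ2),
    Kernel.map_subst_apply' hzρs θ (W₂.formalInvDiff.map ρ)]
  exact H1

end Summit.BirchSwinnertonDyer.BirchSwinnertonDyer.Theorems.DepletionAtTwo.KEta.TheoremKPadic
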